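import Summits.QuantumFields.YangMills.Theorems.UnitScaleTiltProp8ChartHInvTent
import HarnessLib

/-!
# Route `UnitScaleTilt`, crux K1 «MinimiserStabilityRegPr» (stmt-QuantumFields-19200), leaf V2′ — the P2→P3 BRIDGE (hH of `ChartRemainderAt`),
# part B2′(i): **THE C^{1,1} BUMP AND ITS ONE-COORDINATE FACTOR** — first and second differences, including the steps across a block face
# (WANTED №g26-1 (X3′), OWNER RULING g26 04:53:50Z; the tent itself is part B2′(ii) `…ChartHInvSmoothTent`)

Cell `ym3-torus`, width seat `ym-ust-19200-w5` gen 3 (count-neutral helper; `--supports stmt-QuantumFields-19200 --as helper`; def-free, 0 sorry).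

WHY.  Part B2 (`ChartHInvTent.exists_tent`, p1 g18) spreads the pinned comb values of the bridge `H X = H₀X̃′ + dφ` by PIECEWISE-LINEAR pyramids
`1 − (2/(N+1))|o − c|` (kink on the centre hyperplanes: second difference `−4/(N+1)` = first-difference order), so the chart-`H` of record has the (46) SUP row but
NO k-uniform (46) GRADIENT row (`w 2 b·L^{K−n}·‖HX(b+e_ν) − HX(b)‖`, the second letter of F4's currency — LOCATED ✗ (X3), seat w5 g3 04:51Z, owner-accepted).
THIS FILE supplies tents with the SAME identity∕support∕range clauses and BOTH difference rows: the product over the coordinates of the quartic bump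
`G(u) = (4u(1−u))²` read at the in-block labels `u_o = (o + ½)/N`, `N = L^j` — `G(½) = 1` at the centre label `c = (N−1)/2` (N odd), `G ≤ 16u²`, `G ≤ 16(1−u)²`
(so `≤ 4/N²` at the two face labels, `≤ 36/N²` at the next ones), `|G(a) − G(b)| ≤ 8|a − b|` and `G(u+2h) − 2G(u+h) + G(u) = 16h²(12(u+h−½)² − 1 + 2h²)`
(exact algebra) — hence slope `8/L^j` and second differences `≤ 64/L^{2j}` on EVERY pair of fine steps, including the steps across a block face (where the
tent drops from `≤ 36/N²` to `0`).  MECHANISM: the tent is a product of ONE-COORDINATE functions `h_μ(x_μ) = [x_μ.val / N = y_μ.val]·G(u_{x_μ.val % N})` on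
`ZMod (sitesPerDir 0)` (the block indicator folds into the factors, `val_iterBlockOf`), so both rows FACTORISE (`Δ_μΔ_ντ = Δh_μ·Δh_ν·Π` for `μ ≠ ν`,
`Δ_μ²τ = Δ²h_μ·Π`) and every case (interior ∕ face ∕ wrap) is one-dimensional (`z ↦ z + 1` on `ZMod M`, `N ∣ M`).

WHAT THIS FILE PROVES (no definition; the profile and the tent live inside the statements ∕ the `∃`):
* §1 the bump on `ℝ`: `bump_mem_unit`, `bump_half`, `bump_sub_eq`, `abs_bump_sub_le` (`≤ 8|a−b|`), `bump_d2_eq`, `abs_bump_d2_le` (`≤ 64h²`), `bump_le_sq_left/right`;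
* §2 one coordinate on `ZMod M` (`N ∣ M`, `1 < M`): `val_add_one_mod`, `val_add_one_div`, `coordFn_mem_unit`, `abs_coordFn_step_le` (`≤ 8/N`),
  `abs_coordFn_step2_le` (`≤ 64/N²`);
(§3, the product tent `exists_smoothTent` with both rows, is the next file `…ChartHInvSmoothTent`.)
HONEST SCOPE: real arithmetic and `ZMod` bookkeeping only.  NOT a claim about the mass gap.

References: T. Bałaban, CMP **102** (1985) 277–309 [Balaban1985Variational] ((46) p.285, (152) p.301); CMP **96** (1984) 223–250 [Balaban1984PropagatorsII]
((2.147) p.248); CMP **109** (1987) 249–301 [Balaban1987RG1] ((0.1) pp.251–252).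
-/

set_option autoImplicit false

noncomputable section

open scoped BigOperators

namespace Summit.QuantumFields.YangMills.Theorems.ChartHInv

open Literature.MathematicalPhysics.QuantumFieldTheory.Balaban1983to89
open B5Eq118OneStroke (iterBlockOf val_iterBlockOf)
open B15DeterminingSets (embIter)
open Literature.MathematicalPhysics.QuantumFieldTheory.BalabanImbrieJaffe1984to88.BIJ88RT51Background (iterBlockOf_embIter)
open Literature.MathematicalPhysics.QuantumFieldTheory.BalabanImbrieJaffe1984to88 (BIJ88BlockCentredWeight.pow_dvd_sitesPerDir)

/-! ## §1 The quartic bump `G(u) = (4u(1−u))²` -/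

section Bump

/-- `0 ≤ G(u) ≤ 1` on `[0, 1]`. [folklore] -/
theorem bump_mem_unit {u : ℝ} (h0 : 0 ≤ u) (h1 : u ≤ 1) : 0 ≤ (4 * u * (1 - u)) ^ 2 ∧ (4 * u * (1 - u)) ^ 2 ≤ 1 := by
  refine ⟨sq_nonneg _, ?_⟩
  have h : 0 ≤ 4 * u * (1 - u) ∧ 4 * u * (1 - u) ≤ 1 := ⟨by nlinarith, by nlinarith [sq_nonneg (2 * u - 1)]⟩
  nlinarith

/-- `G(½) = 1`. [folklore] -/
theorem bump_half : (4 * (1 / 2 : ℝ) * (1 - 1 / 2)) ^ 2 = 1 := by norm_num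

/-- `G(a) − G(b) = 16(a − b)(1 − a − b)(a(1−a) + b(1−b))`. [folklore] -/
theorem bump_sub_eq (a b : ℝ) :
    (4 * a * (1 - a)) ^ 2 - (4 * b * (1 - b)) ^ 2 = 16 * (a - b) * (1 - a - b) * (a * (1 - a) + b * (1 - b)) := by ring

/-- The bump is `8`-Lipschitz on `[0, 1]`. [folklore] -/
theorem abs_bump_sub_le {a b : ℝ} (ha0 : 0 ≤ a) (ha1 : a ≤ 1) (hb0 : 0 ≤ b) (hb1 : b ≤ 1) :
    |(4 * a * (1 - a)) ^ 2 - (4 * b * (1 - b)) ^ 2| ≤ 8 * |a - b| := by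
  rw [bump_sub_eq, show 16 * (a - b) * (1 - a - b) * (a * (1 - a) + b * (1 - b)) = (a - b) * (16 * ((1 - a - b) * (a * (1 - a) + b * (1 - b)))) by ring,
    abs_mul, mul_comm]
  refine mul_le_mul_of_nonneg_right ?_ (abs_nonneg _)
  rw [abs_le]
  have h1 : |1 - a - b| ≤ 1 := by rw [abs_le]; constructor <;> linarith
  have h2 : 0 ≤ a * (1 - a) + b * (1 - b) := by nlinarith
  have h3 : a * (1 - a) + b * (1 - b) ≤ 1 / 2 := by nlinarith [sq_nonneg (2 * a - 1), sq_nonneg (2 * b - 1)]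
  have h4 : |(1 - a - b) * (a * (1 - a) + b * (1 - b))| ≤ 1 / 2 := by
    rw [abs_mul, abs_of_nonneg h2]
    calc |1 - a - b| * (a * (1 - a) + b * (1 - b)) ≤ 1 * (1 / 2) := mul_le_mul h1 h3 h2 zero_le_one
      _ = 1 / 2 := by ring
  rw [abs_le] at h4
  constructor <;> linarith [h4.1, h4.2]

/-- The second difference of the bump, EXACTLY: `G(u+2h) − 2G(u+h) + G(u) = 16h²(12(u+h−½)² − 1 + 2h²)`. [folklore] -/
theorem bump_d2_eq (u h : ℝ) :
    (4 * (u + 2 * h) * (1 - (u + 2 * h))) ^ 2 - 2 * (4 * (u + h) * (1 - (u + h))) ^ 2 + (4 * u * (1 - u)) ^ 2 =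
      16 * h ^ 2 * (12 * (u + h - 1 / 2) ^ 2 - 1 + 2 * h ^ 2) := by ring

/-- `|G(u+2h) − 2G(u+h) + G(u)| ≤ 64h²` whenever the middle label is in the block (`|u + h − ½| ≤ ½`) and `0 ≤ h ≤ 1`. [folklore] -/
theorem abs_bump_d2_le {u h : ℝ} (hmid : |u + h - 1 / 2| ≤ 1 / 2) (hh0 : 0 ≤ h) (hh1 : h ≤ 1) :
    |(4 * (u + 2 * h) * (1 - (u + 2 * h))) ^ 2 - 2 * (4 * (u + h) * (1 - (u + h))) ^ 2 + (4 * u * (1 - u)) ^ 2| ≤ 64 * h ^ 2 := by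
  rw [bump_d2_eq, abs_mul, abs_of_nonneg (by positivity : (0 : ℝ) ≤ 16 * h ^ 2)]
  have hsq : (u + h - 1 / 2) ^ 2 ≤ 1 / 4 := by
    have := abs_le.1 hmid; nlinarith [this.1, this.2]
  have h4 : |12 * (u + h - 1 / 2) ^ 2 - 1 + 2 * h ^ 2| ≤ 4 := by
    rw [abs_le]; constructor <;> nlinarith [sq_nonneg (u + h - 1 / 2)]
  nlinarith [sq_nonneg h]

/-- `G(u) ≤ 16u²` for `0 ≤ u ≤ 1` (small at the left face). [folklore] -/
theorem bump_le_sq_left {u : ℝ} (h0 : 0 ≤ u) (h1 : u ≤ 1) : (4 * u * (1 - u)) ^ 2 ≤ 16 * u ^ 2 := by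
  nlinarith [sq_nonneg u, mul_nonneg h0 (sub_nonneg.2 h1)]

/-- `G(u) ≤ 16(1−u)²` for `0 ≤ u ≤ 1` (small at the right face). [folklore] -/
theorem bump_le_sq_right {u : ℝ} (h0 : 0 ≤ u) (h1 : u ≤ 1) : (4 * u * (1 - u)) ^ 2 ≤ 16 * (1 - u) ^ 2 := by
  nlinarith [sq_nonneg (1 - u), mul_nonneg h0 (sub_nonneg.2 h1)]

end Bump

/-! ## §2 One coordinate: the factor `h(z) = [z.val / N = q₀]·G((z.val % N + ½)/N)` on `ZMod M`, `N ∣ M` -/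

section Coord

variable {M : ℕ} [NeZero M] {N : ℕ}

/-- Labels step by one modulo `N` along `z ↦ z + 1` (`N ∣ M`). [cite: Balaban1987RG1, (0.1) p.251] -/
theorem val_add_one_mod [Fact (1 < M)] (hNM : N ∣ M) (z : ZMod M) : (z + 1).val % N = (z.val % N + 1) % N := by
  rw [ZMod.val_add, ZMod.val_one, Nat.mod_mod_of_dvd _ hNM, Nat.add_mod]
  conv_rhs => rw [Nat.add_mod, Nat.mod_mod]

/-- Inside a block (label `< N − 1`) the block index does not change along `z ↦ z + 1`, and the value steps by one. [cite: Balaban1987RG1, (0.1) p.251] -/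
theorem val_add_one_of_lt [Fact (1 < M)] (hNM : N ∣ M) (z : ZMod M) (hlt : z.val % N + 1 < N) : (z + 1).val = z.val + 1 := by
  rw [ZMod.val_add, ZMod.val_one]
  apply Nat.mod_eq_of_lt
  have hle : z.val + 1 ≤ M := ZMod.val_lt z
  rcases hle.lt_or_eq with h | h
  · exact h
  · exfalso
    obtain ⟨q, hq⟩ := hNM
    have hmod : (z.val + 1) % N = 0 := by rw [h, hq, Nat.mul_mod_right]
    rw [Nat.add_mod, Nat.one_mod_eq_one.mpr (by omega : N ≠ 1) ] at hmod
    have : (z.val % N + 1) % N = z.val % N + 1 := Nat.mod_eq_of_lt hlt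
    omega

omit [NeZero M] in
variable (N) in
/-- The one-coordinate factor takes values in `[0, 1]`. [folklore] -/
theorem coordFn_mem_unit (hN : 0 < N) (q₀ : ℕ) (h : ZMod M → ℝ)
    (hh : ∀ z, h z = if z.val / N = q₀ then (4 * ((((z.val % N : ℕ) : ℝ) + 1 / 2) / N) * (1 - (((z.val % N : ℕ) : ℝ) + 1 / 2) / N)) ^ 2 else 0) (z : ZMod M) :
    0 ≤ h z ∧ h z ≤ 1 := by
  rw [hh]
  split_ifs
  · have hlt : z.val % N < N := Nat.mod_lt _ hN
    refine bump_mem_unit (by positivity) ?_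
    rw [div_le_one (by exact_mod_cast hN)]
    have : ((z.val % N : ℕ) : ℝ) + 1 ≤ N := by exact_mod_cast hlt
    linarith
  · exact ⟨le_rfl, zero_le_one⟩

/-- label bounds: `0 ≤ u_o ≤ 1` and the face estimates `G(u_o) ≤ 36/N²` for `o ≤ 1` or `o ≥ N − 2`. [folklore] -/
theorem bump_label_facts (hN : 0 < N) (o : ℕ) (ho : o < N) :
    0 ≤ (((o : ℝ) + 1 / 2) / N) ∧ (((o : ℝ) + 1 / 2) / N) ≤ 1 ∧
      ((o ≤ 1 ∨ N ≤ o + 2) → (4 * (((o : ℝ) + 1 / 2) / N) * (1 - ((o : ℝ) + 1 / 2) / N)) ^ 2 ≤ 36 / (N : ℝ) ^ 2) := by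
  have hNr : (0 : ℝ) < N := by exact_mod_cast hN
  have hor : (o : ℝ) + 1 ≤ N := by exact_mod_cast ho
  have hu0 : 0 ≤ (((o : ℝ) + 1 / 2) / N) := by positivity
  have hu1 : (((o : ℝ) + 1 / 2) / N) ≤ 1 := by rw [div_le_one hNr]; linarith
  refine ⟨hu0, hu1, fun hface => ?_⟩
  rcases hface with hlo | hhi
  · -- near the left face: `u ≤ 3/(2N)`
    have hu : (((o : ℝ) + 1 / 2) / N) ≤ 3 / (2 * N) := by
      rw [div_le_div_iff₀ hNr (by positivity)]
      have : (o : ℝ) ≤ 1 := by exact_mod_cast hlo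
      nlinarith
    calc (4 * (((o : ℝ) + 1 / 2) / N) * (1 - ((o : ℝ) + 1 / 2) / N)) ^ 2 ≤ 16 * ((((o : ℝ) + 1 / 2) / N)) ^ 2 := bump_le_sq_left hu0 hu1
      _ ≤ 16 * (3 / (2 * N)) ^ 2 := by gcongr
      _ = 36 / (N : ℝ) ^ 2 := by field_simp; ring
  · -- near the right face: `1 − u ≤ 3/(2N)`
    have hu : 1 - (((o : ℝ) + 1 / 2) / N) ≤ 3 / (2 * N) := by
      rw [sub_le_iff_le_add, div_add_div _ _ (by positivity) hNr.ne', le_div_iff₀ (by positivity)]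
      have : (N : ℝ) ≤ o + 2 := by exact_mod_cast hhi
      nlinarith
    have h1u : 0 ≤ 1 - (((o : ℝ) + 1 / 2) / N) := sub_nonneg.2 hu1
    calc (4 * (((o : ℝ) + 1 / 2) / N) * (1 - ((o : ℝ) + 1 / 2) / N)) ^ 2 ≤ 16 * (1 - (((o : ℝ) + 1 / 2) / N)) ^ 2 := bump_le_sq_right hu0 hu1
      _ ≤ 16 * (3 / (2 * N)) ^ 2 := by gcongr
      _ = 36 / (N : ℝ) ^ 2 := by field_simp; ring

/-- `G(u_o) ≤ 4/N²` at the two face labels `o = 0`, `o = N − 1`. [folklore] -/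
theorem bump_face_le (hN : 0 < N) (o : ℕ) (ho : o < N) (hface : o = 0 ∨ o + 1 = N) :
    (4 * (((o : ℝ) + 1 / 2) / N) * (1 - ((o : ℝ) + 1 / 2) / N)) ^ 2 ≤ 4 / (N : ℝ) ^ 2 := by
  have hNr : (0 : ℝ) < N := by exact_mod_cast hN
  obtain ⟨hu0, hu1, -⟩ := bump_label_facts hN o ho
  rcases hface with h0 | h1
  · subst h0
    calc (4 * ((((0 : ℕ) : ℝ) + 1 / 2) / N) * (1 - (((0 : ℕ) : ℝ) + 1 / 2) / N)) ^ 2 ≤ 16 * (((((0 : ℕ) : ℝ) + 1 / 2) / N)) ^ 2 :=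
          bump_le_sq_left hu0 hu1
      _ = 4 / (N : ℝ) ^ 2 := by push_cast; field_simp; ring
  · have ho' : (o : ℝ) + 1 = N := by exact_mod_cast h1
    calc (4 * (((o : ℝ) + 1 / 2) / N) * (1 - ((o : ℝ) + 1 / 2) / N)) ^ 2 ≤ 16 * (1 - (((o : ℝ) + 1 / 2) / N)) ^ 2 := bump_le_sq_right hu0 hu1
      _ = 4 / (N : ℝ) ^ 2 := by rw [← ho']; field_simp; ring

/-- bookkeeping: two values in `[0, 4t]` differ by at most `8t`. [folklore] -/
theorem abs_sub_le_of_small {a b t : ℝ} (ha0 : 0 ≤ a) (hb0 : 0 ≤ b) (ha : a ≤ 4 * t) (hb : b ≤ 4 * t) : |a - b| ≤ 8 * t := by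
  rw [abs_le]; constructor <;> linarith

/-- bookkeeping: `|c − 2b + a| ≤ 64t` for `a, c ∈ [0, 36t]`, `b ∈ [0, 4t]`, `a + c ≤ 40t`, `t ≥ 0`. [folklore] -/
theorem abs_d2_le_of_small {a b c t : ℝ} (ht : 0 ≤ t) (hb0 : 0 ≤ b) (hb : b ≤ 4 * t) (ha0 : 0 ≤ a) (hc0 : 0 ≤ c) (hac : a + c ≤ 40 * t) :
    |c - 2 * b + a| ≤ 64 * t := by
  rw [abs_le]; constructor <;> linarith

section Factor

variable [Fact (1 < M)] (hN : 0 < N) (hNM : N ∣ M) (q₀ : ℕ) (h : ZMod M → ℝ)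
  (hh : ∀ z, h z = if z.val / N = q₀ then (4 * ((((z.val % N : ℕ) : ℝ) + 1 / 2) / N) * (1 - (((z.val % N : ℕ) : ℝ) + 1 / 2) / N)) ^ 2 else 0)

omit [NeZero M] [Fact (1 < M)] in
include hh hN in
/-- The factor is bounded by the bump at its label, and is nonnegative. [folklore] -/
theorem coordFn_le_bump (z : ZMod M) :
    0 ≤ h z ∧ h z ≤ (4 * ((((z.val % N : ℕ) : ℝ) + 1 / 2) / N) * (1 - (((z.val % N : ℕ) : ℝ) + 1 / 2) / N)) ^ 2 := by
  have hb := (bump_label_facts hN (z.val % N) (Nat.mod_lt _ hN))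
  have h01 := bump_mem_unit hb.1 hb.2.1
  rw [hh]
  split_ifs
  · exact ⟨h01.1, le_rfl⟩
  · exact ⟨le_rfl, h01.1⟩

include hh hN hNM in
/-- One step inside a block: the label moves by one, the block index is unchanged. [cite: Balaban1987RG1, (0.1) p.251] -/
theorem coordFn_add_one_of_lt (z : ZMod M) (hlt : z.val % N + 1 < N) :
    h (z + 1) = if z.val / N = q₀ then (4 * (((((z.val % N + 1 : ℕ)) : ℝ) + 1 / 2) / N) * (1 - ((((z.val % N + 1 : ℕ)) : ℝ) + 1 / 2) / N)) ^ 2 else 0 := by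
  have hval : (z + 1).val = z.val + 1 := val_add_one_of_lt hNM z hlt
  have hmod : (z + 1).val % N = z.val % N + 1 := by
    rw [hval, Nat.add_mod, Nat.one_mod_eq_one.mpr (by omega : N ≠ 1), Nat.mod_eq_of_lt hlt]
  have hdiv : (z + 1).val / N = z.val / N := by
    rw [hval]
    have hdm := Nat.div_add_mod z.val N
    conv_lhs => rw [← hdm, Nat.add_assoc, Nat.mul_add_div hN, Nat.div_eq_of_lt hlt]
    rw [add_zero]
  rw [hh, hmod, hdiv]

include hh hN hNM in
/-- **FIRST DIFFERENCES OF THE FACTOR**: `|h(z+1) − h(z)| ≤ 8/N` (inside a block: the bump's Lipschitz constant `8` times the label step `1/N`; across a face both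
values are `≤ 4/N²`). [cite: Balaban1984PropagatorsII, (2.147) p.248] -/
theorem abs_coordFn_step_le (z : ZMod M) : |h (z + 1) - h z| ≤ 8 / (N : ℝ) := by
  have hNr : (0 : ℝ) < N := by exact_mod_cast hN
  have hN1 : (1 : ℝ) ≤ N := by exact_mod_cast hN
  have ho : z.val % N < N := Nat.mod_lt _ hN
  by_cases hlt : z.val % N + 1 < N
  · rw [coordFn_add_one_of_lt hN hNM q₀ h hh z hlt, hh z]
    split_ifs
    · obtain ⟨ha0, ha1, -⟩ := bump_label_facts hN (z.val % N + 1) hlt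
      obtain ⟨hb0, hb1, -⟩ := bump_label_facts hN (z.val % N) ho
      refine (abs_bump_sub_le ha0 ha1 hb0 hb1).trans ?_
      rw [show ((((z.val % N + 1 : ℕ)) : ℝ) + 1 / 2) / N - (((z.val % N : ℕ) : ℝ) + 1 / 2) / N = 1 / N by push_cast; field_simp; ring,
        abs_of_pos (by positivity)]
      exact le_of_eq (by ring)
    · rw [sub_zero, abs_zero]; positivity
  · -- across a face: label `N − 1` then label `0`
    have heq : z.val % N + 1 = N := by omega
    have h0 : (z + 1).val % N = 0 := by rw [val_add_one_mod hNM, heq, Nat.mod_self]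
    obtain ⟨hz0, hz⟩ := coordFn_le_bump hN q₀ h hh z
    obtain ⟨hz0', hz'⟩ := coordFn_le_bump hN q₀ h hh (z + 1)
    have hz1 : h z ≤ 4 / (N : ℝ) ^ 2 := hz.trans (bump_face_le hN _ ho (Or.inr heq))
    have hz1' : h (z + 1) ≤ 4 / (N : ℝ) ^ 2 := by
      refine hz'.trans ?_
      rw [h0]
      exact bump_face_le hN 0 hN (Or.inl rfl)
    have h8 : 8 * (1 / (N : ℝ) ^ 2) ≤ 8 / (N : ℝ) := by
      rw [← div_eq_mul_one_div, div_le_div_iff₀ (by positivity) hNr]; nlinarith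
    rw [div_eq_mul_one_div] at hz1 hz1'
    exact (abs_sub_le_of_small hz0' hz0 hz1' hz1).trans h8

include hh hN hNM in
/-- **SECOND DIFFERENCES OF THE FACTOR**: `|h(z+2) − 2h(z+1) + h(z)| ≤ 64/N²` (three labels inside a block: `abs_bump_d2_le`; across a face the three values are
`≤ 36/N², 4/N², 4/N²` in some order, total `≤ 48/N²`). [cite: Balaban1984PropagatorsII, (2.147) p.248] -/
theorem abs_coordFn_step2_le (z : ZMod M) : |h (z + 1 + 1) - 2 * h (z + 1) + h z| ≤ 64 / (N : ℝ) ^ 2 := by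
  have hNr : (0 : ℝ) < N := by exact_mod_cast hN
  have hN1 : (1 : ℝ) ≤ N := by exact_mod_cast hN
  have ho : z.val % N < N := Nat.mod_lt _ hN
  by_cases h2 : z.val % N + 2 < N
  · -- three labels inside the block
    have hlt : z.val % N + 1 < N := by omega
    have hz1 := coordFn_add_one_of_lt hN hNM q₀ h hh z hlt
    have hval : (z + 1).val = z.val + 1 := val_add_one_of_lt hNM z hlt
    have hmod1 : (z + 1).val % N = z.val % N + 1 := by
      rw [hval, Nat.add_mod, Nat.one_mod_eq_one.mpr (by omega : N ≠ 1), Nat.mod_eq_of_lt hlt]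
    have hdiv1 : (z + 1).val / N = z.val / N := by
      rw [hval]
      have hdm := Nat.div_add_mod z.val N
      conv_lhs => rw [← hdm, Nat.add_assoc, Nat.mul_add_div hN, Nat.div_eq_of_lt hlt]
      rw [add_zero]
    have hlt' : (z + 1).val % N + 1 < N := by rw [hmod1]; omega
    have hz2 := coordFn_add_one_of_lt hN hNM q₀ h hh (z + 1) hlt'
    rw [hmod1, hdiv1] at hz2
    rw [hz2, hz1, hh z]
    split_ifs
    · obtain ⟨hb0, hb1, -⟩ := bump_label_facts hN (z.val % N) ho
      have e1 : ((((z.val % N + 1 : ℕ)) : ℝ) + 1 / 2) / N = (((z.val % N : ℕ) : ℝ) + 1 / 2) / N + 1 / N := by push_cast; field_simp; ring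
      have e2 : ((((z.val % N + 1 + 1 : ℕ)) : ℝ) + 1 / 2) / N = (((z.val % N : ℕ) : ℝ) + 1 / 2) / N + 2 * (1 / N) := by push_cast; field_simp; ring
      rw [e1, e2]
      have hmid : |(((z.val % N : ℕ) : ℝ) + 1 / 2) / N + 1 / N - 1 / 2| ≤ 1 / 2 := by
        have hle : (((z.val % N : ℕ) : ℝ)) + 2 ≤ N := by exact_mod_cast h2.le
        rw [abs_le]; constructor
        · have : 0 ≤ (((z.val % N : ℕ) : ℝ) + 1 / 2) / N + 1 / N := by positivity
          linarith
        · rw [show (((z.val % N : ℕ) : ℝ) + 1 / 2) / N + 1 / N - 1 / 2 = ((((z.val % N : ℕ) : ℝ) + 3 / 2) - N / 2) / N by field_simp; ring,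
            div_le_iff₀ hNr]
          linarith
      refine (abs_bump_d2_le hmid (by positivity) (by rw [div_le_one hNr]; exact hN1)).trans ?_
      rw [show (64 : ℝ) * (1 / N) ^ 2 = 64 / (N : ℝ) ^ 2 by field_simp]
    · rw [mul_zero, sub_zero, add_zero, abs_zero]; positivity
  · -- at most two steps from the right face: the three values are small
    have hmod1 : (z + 1).val % N = (z.val % N + 1) % N := val_add_one_mod hNM z
    have hmod2 : (z + 1 + 1).val % N = (z.val % N + 2) % N := by
      rw [val_add_one_mod hNM, hmod1, Nat.add_mod, Nat.mod_mod, ← Nat.add_mod]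
    obtain ⟨ha0, ha⟩ := coordFn_le_bump hN q₀ h hh z
    obtain ⟨hb0, hb⟩ := coordFn_le_bump hN q₀ h hh (z + 1)
    obtain ⟨hc0, hc⟩ := coordFn_le_bump hN q₀ h hh (z + 1 + 1)
    rcases Nat.lt_or_ge (z.val % N + 1) N with hlt | hge
    · -- `o = N − 2`: values ≤ 36, 4, 4
      have heq : z.val % N + 2 = N := by omega
      have l1 : (z + 1).val % N + 1 = N := by rw [hmod1, Nat.mod_eq_of_lt hlt]; omega
      have l2 : (z + 1 + 1).val % N = 0 := by rw [hmod2, heq, Nat.mod_self]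
      have va : h z ≤ 36 / (N : ℝ) ^ 2 := ha.trans ((bump_label_facts hN _ ho).2.2 (Or.inr (by omega)))
      have vb : h (z + 1) ≤ 4 / (N : ℝ) ^ 2 := hb.trans (bump_face_le hN _ (Nat.mod_lt _ hN) (Or.inr l1))
      have vc : h (z + 1 + 1) ≤ 4 / (N : ℝ) ^ 2 := by
        refine hc.trans ?_; rw [l2]; exact bump_face_le hN 0 hN (Or.inl rfl)
      rw [div_eq_mul_one_div] at va vb vc ⊢
      exact abs_d2_le_of_small (by positivity) hb0 vb ha0 hc0 (by linarith)
    · -- `o = N − 1`: values ≤ 4, 4, 36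
      have heq : z.val % N + 1 = N := by omega
      have l1 : (z + 1).val % N = 0 := by rw [hmod1, heq, Nat.mod_self]
      have l2 : (z + 1 + 1).val % N ≤ 1 := by
        rw [hmod2, show z.val % N + 2 = N + 1 by omega, Nat.add_mod_left]
        exact (Nat.mod_le 1 N)
      have va : h z ≤ 4 / (N : ℝ) ^ 2 := ha.trans (bump_face_le hN _ ho (Or.inr heq))
      have vb : h (z + 1) ≤ 4 / (N : ℝ) ^ 2 := by
        refine hb.trans ?_; rw [l1]; exact bump_face_le hN 0 hN (Or.inl rfl)
      have vc : h (z + 1 + 1) ≤ 36 / (N : ℝ) ^ 2 := hc.trans ((bump_label_facts hN _ (Nat.mod_lt _ hN)).2.2 (Or.inl l2))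
      rw [div_eq_mul_one_div] at va vb vc ⊢
      exact abs_d2_le_of_small (by positivity) hb0 vb ha0 hc0 (by linarith)

end Factor

end Coord

end Summit.QuantumFields.YangMills.Theorems.ChartHInv

end
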